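import Summits.ResolutionOfSingularities.ResolutionOfSingularities.Theorems.HilbertSamuelEliminationSigmaMaxModificationsCorridor3WLadderHybridLowSwallow
import Summits.ResolutionOfSingularities.ResolutionOfSingularities.Theorems.HilbertSamuelEliminationSigmaMaxModificationsCorridor3WLadderStrataReplay
import HarnessLib

/-!
# [OURS · L1 W4.2] `Corridor3WLadderHybridLowReplayDefs` — the From-`s₀` row (c-reg) «AT LATE CYCLE STARTS THE REDUCED TREATED PART IS REGULAR AT
# THE CHAIN POINT» for an arbitrary boundary-reading strategy (binder of the (c-rep) supplier `…WLadderHybridLowReplay`)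

Crux chain w42 (`SigmaMaxModifications`, stmt-ResolutionOfSingularities-18506; conjunct `SigmaMaxModificationsCorridor3`,
stmt-ResolutionOfSingularities-19249), CHAIN v3.20 §0s.4 «040: HybridLow follow-ups ((c-rep)/(c-menu) suppliers)»; res-type-040's memo
`HOME/plan/tools/res-type-040/LOW-SUPPLIERS-memo.md` (47a2e00fad984739) §2 (c-rep). Typer res-type-040 (gen 19). ONE `def … : Prop` row
(OPEN binder; nothing claimed) — the From-`s₀` σE-copy of res-L1-w42-stub-4's `Moving.StrataCycleStartRegular` (`…WLadderStrataReplay`, whose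
`treatedPartIdeal` it reuses). OURS (cell res-hironaka, slot W4.2); NOT a statement of H. Hironaka's manuscript [Hironaka2017] nor of
[CossartJannsenSaito2020]; AI-typed, weaker than expert review. Helper vocabulary `--supports stmt-ResolutionOfSingularities-19249 --as helper`
(counted 0). References: CJS LNM 2270 Rem. 6.29 (1), p. 102, Thm. 3.6, Thm. 3.14 [CossartJannsenSaito2020]; tree `…WLadderStrataReplay`
(stub-4: `StrataCycleStartRegular`, `strataReplayBlowupsSettle_of_cycleStartRegular`), `…WLadderHybridLowSwallow` (p535770: `StrataReplaySettleFromσE`).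
-/

noncomputable section

set_option linter.dupNamespace false

open CategoryTheory AlgebraicGeometry TopologicalSpace Topology
open Summit.ResolutionOfSingularities.ResolutionOfSingularities.Theorems.CampaignW42
open Literature.AlgebraicGeometry.Resolution Literature.RingTheory.HilbertSamuel
open Summit.ResolutionOfSingularities.ResolutionOfSingularities.Theorems.SigmaMaxModificationsCorridor3
open Summit.ResolutionOfSingularities.ResolutionOfSingularities.Theorems.SigmaMaxModificationsCorridor3.Moving

namespace Summit.ResolutionOfSingularities.ResolutionOfSingularities.Theorems.SigmaMaxModificationsCorridor3.Sigma

universe u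

/-- [OURS · L1 W4.2] **ROW (c-reg)From — AT LATE STATES BETWEEN CYCLES THE REDUCED TREATED PART IS REGULAR AT THE CHAIN POINT, from `s₀`, for the
boundary-reading strategy `σ`** (From-`s₀` σE-copy of stub-4's `Moving.StrataCycleStartRegular`): along every moving, never-isolated `G`-chain of
σE-steps whose start is σ-reached from `s₀`, from some stage on, whenever `X_r` is between cycles (`(c r).P = none`; the next fallback cycle treats
the least non-empty label `j = treatedLabel`), every point of the reduced treated part `S_r = (Y_r^{(j)})_red` lying over the chain point `x_r` is a
REGULAR point of `S_r`. For the menu hybrid with the (P1)-first tiers no surface component survives at τ-time, so the parts through a W-low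
chain point are curves and the intended discharge is stub-4's «after the early labels the label part through the chain point is ONE regular
curve» (Thm. 3.6, Thm. 3.14 at the generic point, near-fibre form F-61). OURS row, OPEN as a binder; NOT a statement of the manuscript.
[cite: CossartJannsenSaito2020, Rem. 6.29 (1), Thm. 3.6, Thm. 3.14] -/
def StrataCycleStartRegularFromσE (σ : StrategyE.{u}) (N : ℕ) (ν : ℕ → ℕ) (s₀ : MarkedStageE.{u}) (G : MarkedStage.{u} → Prop) :
    Prop :=
  ∀ c : ℕ → MarkedStageE.{u}, ReachesσE σ N ν s₀ (c 0) → (∀ n, CanonicalNearStepσE σ N ν (c n) (c (n + 1))) →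
    (∀ n, G (c n).toMarkedStage) → (∀ n, ¬ Iso N (c n).toMarkedStage) → (∀ n, ∃ m, n ≤ m ∧ (c m).IsBlownUpσE σ N ν) →
    ∃ n₁, ∀ r, n₁ ≤ r → (c r).P = none →
      ∀ (hcl : IsClosed ((c r).L.part (Scheme.hsStratum (c r).W N ν) (treatedLabel N ν (c r).toMarkedStage)))
        (y : ↥((treatedPartIdeal N ν (c r).toMarkedStage (treatedLabel N ν (c r).toMarkedStage) hcl).subscheme)),
        (treatedPartIdeal N ν (c r).toMarkedStage (treatedLabel N ν (c r).toMarkedStage) hcl).subschemeι.base y = (c r).pt →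
          y ∈ Scheme.regularLocus (treatedPartIdeal N ν (c r).toMarkedStage (treatedLabel N ν (c r).toMarkedStage) hcl).subscheme

/-- (c-reg)From is inherited by σ-reached states and by smaller grades. [folklore] -/
theorem StrataCycleStartRegularFromσE.of_reaches_mono {σ : StrategyE.{u}} {N : ℕ} {ν : ℕ → ℕ} {s₀ s₁ : MarkedStageE.{u}}
    {G G' : MarkedStage.{u} → Prop} (h : StrataCycleStartRegularFromσE σ N ν s₀ G) (hr : ReachesσE σ N ν s₀ s₁)
    (hG : ∀ s, G' s → G s) : StrataCycleStartRegularFromσE σ N ν s₁ G' :=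
  fun c h0 hstep hG' hnI hmov => h c (hr.trans h0) hstep (fun n => hG _ (hG' n)) hnI hmov

end Summit.ResolutionOfSingularities.ResolutionOfSingularities.Theorems.SigmaMaxModificationsCorridor3.Sigma

end
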